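import Literature.Topology.FourManifolds.LongAnnulusRotate
import Literature.Topology.FourManifolds.LongAnnulusFlatten
import HarnessLib

/-!
# A long annulus with flat collars has a flat level-true strip (assembly)

Topic `Literature/Topology/FourManifolds`; assembly of the straightening of a spanning arc in the
proof programme of the Fox–Milnor fact
`Literature.Topology.FourManifolds.Knot.exists_isConnectedSum_isConcordant`. Everything here is
proved; no named fact is introduced.

`LongAnnulus.exists_flat_strip`: a long annulus `A` of width `η` whose end curves are the same
straight arc near `θ₁` (`A.FlatAt θ₁ ζ x₀ e σ`) can be replaced by a long annulus `D` of width
`η / 4` with the **same end curves** which, near `θ₁ + ℤ`, *is* the level-true flat strip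
`(θ, s) ↦ (x₀ + σ (θ - m) • e, s)` and which is body-free near the axis `{x₀} × ℝ`. Chain:
generic double shear of the spanning arc `θ = θ₁` (`exists_generic_shear`, `LongAnnulusShear`),
re-levelling (`exists_relevel`, `LongAnnulusRelevel`), translation to the axis and first-order
normalisation (`exists_axis_normalised`, `LongAnnulusAxis`/`LongAnnulusRotate`), flattening
(`exists_flatten`, `LongAnnulusFlatten`).

## References

* M. W. Hirsch, *Differential Topology*, GTM 33 (1976), Ch. 4 §§5–6, Ch. 8 §§1–3. [HirschDT1976]

## Design notes

No named facts, no `sorry`; `𝔼 n` is local notation as in `Knots.lean`.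
-/

open scoped Topology ContDiff RealInnerProductSpace
open Function Set Metric Filter

noncomputable section

namespace Literature.Topology.FourManifolds

/-- Local notation: `𝔼 n` is the model Euclidean space `EuclideanSpace ℝ (Fin n)`. -/
local notation "𝔼 " n:arg => EuclideanSpace ℝ (Fin n)

namespace LongAnnulus

variable {η : ℝ} (A : LongAnnulus η)

/-- **A long annulus with flat collars at `θ₁` has a flat level-true strip.** There is a long
annulus `D` of width `η / 4` with the same end curves and `0 < δ₁ ≤ ζ`, `r' > 0` such that
`D.F (θ, s) = (x₀ + σ (θ - m) • e, s)` whenever `|θ - θ₁ - m| < δ₁`, and every point of `D`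
within distance `r'` of the axis `{x₀} × ℝ` (in space) has parameter within `δ₁` of `θ₁ + ℤ`.
[folklore] -/
theorem exists_flat_strip {θ₁ ζ : ℝ} {x₀ e : 𝔼 3} {σ : ℝ → ℝ} (hf : A.FlatAt θ₁ ζ x₀ e σ) :
    ∃ D : LongAnnulus (η / 4), D.k₁ = A.k₁ ∧ D.k₂ = A.k₂ ∧ ∃ δ₁ r' : ℝ, 0 < δ₁ ∧ δ₁ ≤ ζ ∧ 0 < r' ∧
      (∀ θ s (m : ℤ), |θ - θ₁ - m| < δ₁ → D.F (θ, s) = (x₀ + σ (θ - m) • e, s)) ∧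
      ∀ θ s, ‖(D.F (θ, s)).1 - x₀‖ < r' → ∃ m : ℤ, |θ - θ₁ - m| < δ₁ := by
  have hη := A.η_pos
  -- generic double shear and re-levelling of the spanning arc `θ = θ₁`
  obtain ⟨v, hv₁, hv₂⟩ := A.exists_generic_shear θ₁
  obtain ⟨B, hBk₁, hBk₂, -, -, -, hBarc⟩ := A.exists_relevel θ₁ hv₁ hv₂
  have hfB : B.FlatAt θ₁ ζ x₀ e σ := hf.of_k_eq hBk₁ hBk₂
  have hlev : ∀ s, (B.F (θ₁, s)).2 = s := by
    intro s
    by_cases hs : s ∈ Icc (1 : ℝ) 2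
    · rw [hBarc s hs]
    · rcases not_and_or.1 hs with h | h
      · exact B.snd_F_of_le (by linarith [B.η_pos, not_le.1 h]) θ₁
      · exact B.snd_F_of_ge (by linarith [B.η_pos, not_le.1 h]) θ₁
  -- the axis and the first-order normalisation
  obtain ⟨C, hCk₁, hCk₂, hCax, hCder, -, -⟩ := B.exists_axis_normalised hfB hlev
  have hfC : C.FlatAt θ₁ ζ x₀ e σ := hfB.of_k_eq hCk₁ hCk₂
  -- flattening
  obtain ⟨D, hDk₁, hDk₂, δ₁, r', hδ₁, hδ₁ζ, hr', hstrip, hbody⟩ := C.exists_flatten hfC hCax hCder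
  exact ⟨D, hDk₁.trans (hCk₁.trans hBk₁), hDk₂.trans (hCk₂.trans hBk₂), δ₁, r', hδ₁, hδ₁ζ, hr',
    hstrip, hbody⟩

end LongAnnulus

end Literature.Topology.FourManifolds
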